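import Literature.NumberTheory.DiophantineGeometry.BelyiDegreeFaltingsHeightProofs
import Literature.NumberTheory.DiophantineGeometry.FunctionFieldConstantExtension
import Literature.NumberTheory.DiophantineGeometry.HurwitzSignatureBound
import Mathlib.RingTheory.Norm.Transitivity
import HarnessLib

/-!
# Galois Belyi curves have Belyi degree at most `84(g - 1)` (Hurwitz)

Topic `NumberTheory/DiophantineGeometry`; companion of `BelyiDegreeFaltingsHeightProofs.lean`
(Javanpeykar 2014, Lemma 3.2.2) and `HurwitzSignatureBound.lean`. Javanpeykar 2014, §1.5, before
Cor. 1.5.1: *"If `X` is a Galois Belyi curve, we have `deg_B(X) ≤ 84(g - 1)`. In fact, … this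
inequality holds since the Belyi degree of a Galois Belyi curve is bounded by the cardinality of
its automorphism group,"* i.e. by Hurwitz's theorem `|Aut(X)| ≤ 84(g - 1)`. In the function-field
language of the tree (`K` algebraically closed of characteristic `0`, `F/K` a function field,
`f ∈ F` a Belyi function, `F/K(f)` Galois — so `[F : K(f)] = |Gal(F/K(f))|`):

* `IsBelyiFunction.finrank_le_of_isGalois` — **`g ≥ 2 ⇒ [F : K(f)] ≤ 84 (g - 1)`**.

Proof (Hurwitz's, for the Galois cover `F/K(f)` of `ℙ¹` branched over `⊆ {0, 1, ∞}`):

1. `PlaceOver.comapAlgEquiv`, `PlaceOver.ord_comapAlgEquiv` — `K`-automorphisms transport places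
   and orders, `ord_{σ⁻¹P}(x) = ord_P(σ x)` (Stichtenoth Lemma 3.5.2; these are
   `PlaceOver.comapRingEquiv` / `ord_comapRingEquiv` of `FunctionFieldConstantExtension` /
   `FunctionFieldStepanovProofs` without their `[Finite K]` hypothesis);
2. `PlaceOver.exists_ord_eq_mul_ord_of_mem_adjoin` — for `0 ≠ z ∈ K(t)`, `ord_P z = m · ord_P t`
   with one integer `m` at all zeros `P` of `t` (write `z = r(t)/s(t)` and factor `t`-powers);
3. `PlaceOver.exists_comapAlgEquiv_eq_of_ord_pos` — **`Gal(F/K(f))` is transitive on the zeros of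
   every `t ∈ K(f)` with `K(t) = K(f)`** (Stichtenoth Thm. 3.7.1), by the classical argument: if the
   zero `P'` is not in the orbit of the zero `P`, weak approximation (`PlaceOver.weakApproximation`)
   gives `x` of order `1` at `P'` and a unit at the other zeros; its norm `y = ∏_σ σ(x) ∈ K(f)`
   (Mathlib's `Algebra.norm_eq_prod_automorphisms`) has `ord_P y = 0 < ord_{P'} y`, contradicting 2;
   hence `PlaceOver.ord_eq_ord_of_isGalois` (constant ramification on a fibre, Cor. 3.7.2) and
   `PlaceOver.card_mul_eq_finrank_of_isGalois`: **`n · e = [F : K(f)]`** for the fibre of `t`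
   (`FunctionFieldResidues.sum_ord_sub_eq_finrank`, Thm. 1.4.11), applied to `t = f, f - 1, 1/f`;
4. with the cusp count `n₀ + n₁ + n_∞ = d + 2 - 2g` of `BelyiDegreeFaltingsHeightProofs`
   (Riemann–Hurwitz, characteristic `0`) this is `2g - 2 = d (1 - 1/e₀ - 1/e₁ - 1/e_∞)`, and
   `HurwitzSignatureBound.card_le_of_riemannHurwitz_signature` gives `d ≤ 84(g - 1)`.

Also: `IsBelyiFunction.exists_ramification_of_isGalois` — the Riemann–Hurwitz relation
`d (1/e₀ + 1/e₁ + 1/e_∞) = d + 2 - 2g` with the constant ramification indices `eᵢ ∣ d` of a Galois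
Belyi function; hence the signatures in small genus: `signature_of_isGalois_of_genus_eq_one`
(`{e₀, e₁, e_∞} ∈ {{2,3,6}, {2,4,4}, {3,3,3}}`, via `inv_add_inv_add_inv_eq_one`) and
`signature_of_isGalois_of_genus_eq_zero` (Klein's platonic list `{1,d,d}`, `{2,2,d/2}`,
`{2,3,3; d = 12}`, `{2,3,4; d = 24}`, `{2,3,5; d = 60}`, via `spherical_signature_sorted`).

Theorems and one definition with body (`PlaceOver.comapAlgEquiv`); no named fact.

## References

* A. Hurwitz, Math. Ann. 41 (1893), 403–442 (the bound `84(g - 1)`).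
* H. Stichtenoth, *Algebraic Function Fields and Codes*, 2nd ed., GTM 254 (2009): Lemma 3.5.2,
  Thm. 3.7.1, Cor. 3.7.2, Thm. 1.3.1, Thm. 1.4.11. [Stichtenoth2009]
* A. Javanpeykar, *Polynomial bounds for Arakelov invariants of Belyi curves*, Algebra & Number
  Theory 8 (2014), §1.5 and Cor. 1.5.1. [Javanpeykar2014]
-/

noncomputable section

open scoped IntermediateField
open Polynomial

namespace Literature.NumberTheory.DiophantineGeometry.AlgFunctionField

universe u v

variable {K : Type u} {F : Type v} [Field K] [Field F] [Algebra K F] [IsAlgFunctionField K F]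

namespace PlaceOver

/-! ### Orders of elements of `K(t)` at the zeros of `t` -/

omit [IsAlgFunctionField K F] in
/-- `t ∈ 𝒪_P` when `ord_P t > 0`. [folklore] -/
theorem mem_of_ord_pos (P : PlaceOver K F) {t : F} (ht : 0 < P.ord t) :
    t ∈ P.toValuationSubring := by
  have ht0 : t ≠ 0 := by rintro rfl; rw [PlaceOver.ord_zero] at ht; exact lt_irrefl _ ht
  exact (P.mem_toValuationSubring_iff_ord_nonneg ht0).2 ht.le

omit [IsAlgFunctionField K F] in
/-- Polynomials in an element of `𝒪_P` lie in `𝒪_P`. [folklore] -/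
theorem aeval_mem (P : PlaceOver K F) {t : F} (ht : t ∈ P.toValuationSubring) (p : K[X]) :
    aeval t p ∈ P.toValuationSubring := by
  rw [aeval_eq_sum_range]
  refine Subring.sum_mem _ fun i _ ↦ ?_
  rw [Algebra.smul_def]
  exact mul_mem (P.algebraMap_mem _) (pow_mem ht _)

omit [IsAlgFunctionField K F] in
/-- At a zero `P` of `t`, a polynomial `p(t)` with `p(0) ≠ 0` is a unit: `ord_P p(t) = 0`.
[folklore] -/
theorem ord_aeval_eq_zero_of_eval_ne_zero (P : PlaceOver K F) {t : F} (ht : 0 < P.ord t)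
    {p : K[X]} (hp : p.eval 0 ≠ 0) : aeval t p ≠ 0 ∧ P.ord (aeval t p) = 0 := by
  have ht0 : t ≠ 0 := by rintro rfl; rw [PlaceOver.ord_zero] at ht; exact lt_irrefl _ ht
  -- `p = C (p 0) + X q`
  obtain ⟨q, hq⟩ : X ∣ p - C (p.eval 0) := by
    rw [X_dvd_iff, coeff_sub, coeff_C_zero, coeff_zero_eq_eval_zero, sub_self]
  have hp' : p = C (p.eval 0) + X * q := by rw [← hq]; ring
  have hc0 : P.ord (algebraMap K F (p.eval 0)) = 0 := PlaceOver.ord_algebraMap_holds P hp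
  have hcne : algebraMap K F (p.eval 0) ≠ 0 := (_root_.map_ne_zero _).2 hp
  have haeval : aeval t p = algebraMap K F (p.eval 0) + t * aeval t q := by
    conv_lhs => rw [hp']
    rw [map_add, map_mul, aeval_C, aeval_X]
  rcases eq_or_ne (aeval t q) 0 with hq0 | hq0
  · rw [haeval, hq0, mul_zero, add_zero]
    exact ⟨hcne, hc0⟩
  · have hmem : aeval t q ∈ P.toValuationSubring := P.aeval_mem (P.mem_of_ord_pos ht) q
    have hq' : 0 ≤ P.ord (aeval t q) := (P.mem_toValuationSubring_iff_ord_nonneg hq0).1 hmem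
    have hlt : P.ord (algebraMap K F (p.eval 0)) < P.ord (t * aeval t q) := by
      rw [hc0, P.ord_mul_eq ht0 hq0]; linarith
    have h := P.ord_add_eq_left_of_lt hcne (mul_ne_zero ht0 hq0) hlt
    rw [haeval]
    exact ⟨h.1, h.2.trans hc0⟩

omit [IsAlgFunctionField K F] in
/-- At a zero `P` of `t`: `ord_P p(t) = mult₀(p) · ord_P t` for a non-zero polynomial `p`
(`mult₀` the multiplicity of the root `0`). [folklore] -/
theorem ord_aeval_eq_rootMultiplicity_mul (P : PlaceOver K F) {t : F} (ht : 0 < P.ord t)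
    {p : K[X]} (hp : p ≠ 0) :
    aeval t p ≠ 0 ∧ P.ord (aeval t p) = p.rootMultiplicity 0 * P.ord t := by
  have ht0 : t ≠ 0 := by rintro rfl; rw [PlaceOver.ord_zero] at ht; exact lt_irrefl _ ht
  set m := p.rootMultiplicity 0 with hm
  set q := p /ₘ (X - C 0) ^ m with hq
  have hpq : (X - C (0 : K)) ^ m * q = p := pow_mul_divByMonic_rootMultiplicity_eq p 0
  have hq0 : q.eval 0 ≠ 0 := eval_divByMonic_pow_rootMultiplicity_ne_zero 0 hp
  obtain ⟨hqne, hqord⟩ := P.ord_aeval_eq_zero_of_eval_ne_zero ht hq0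
  have haeval : aeval t p = t ^ m * aeval t q := by
    rw [← hpq, map_mul, map_pow, map_sub, aeval_X, aeval_C, map_zero, sub_zero]
  rw [haeval]
  refine ⟨mul_ne_zero (pow_ne_zero _ ht0) hqne, ?_⟩
  rw [P.ord_mul_eq (pow_ne_zero _ ht0) hqne, P.ord_pow ht0, hqord, add_zero]

omit [IsAlgFunctionField K F] in
/-- **Orders of elements of `K(t)` at the zeros of `t`.** For `0 ≠ z ∈ K(t)` there is an integer
`m` (the order of `z` as a rational function in `t` at `t = 0`) with `ord_P z = m · ord_P t` at
every zero `P` of `t`. In particular the sign of `ord_P z` is the same at all zeros of `t`.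
[folklore] -/
theorem exists_ord_eq_mul_ord_of_mem_adjoin {t z : F} (hz : z ∈ K⟮t⟯) (hz0 : z ≠ 0) :
    ∃ m : ℤ, ∀ P : PlaceOver K F, 0 < P.ord t → P.ord z = m * P.ord t := by
  rw [IntermediateField.mem_adjoin_simple_iff] at hz
  obtain ⟨r, s, hrs⟩ := hz
  have hr : r ≠ 0 := by rintro rfl; rw [map_zero, zero_div] at hrs; exact hz0 hrs
  have hs : aeval t s ≠ 0 := by intro h; rw [h, div_zero] at hrs; exact hz0 hrs
  have hs' : s ≠ 0 := by rintro rfl; exact hs (map_zero _)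
  refine ⟨(r.rootMultiplicity 0 : ℤ) - s.rootMultiplicity 0, fun P hP ↦ ?_⟩
  obtain ⟨hrne, hrord⟩ := P.ord_aeval_eq_rootMultiplicity_mul hP hr
  obtain ⟨-, hsord⟩ := P.ord_aeval_eq_rootMultiplicity_mul hP hs'
  rw [hrs, P.ord_div hrne hs, hrord, hsord]
  ring

/-! ### The order of a product -/

omit [IsAlgFunctionField K F] in
/-- `ord_P (∏ᵢ xᵢ) = Σᵢ ord_P xᵢ` for non-zero factors. [folklore] -/
theorem ord_prod_eq_sum {ι : Type*} (P : PlaceOver K F) (s : Finset ι) (x : ι → F)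
    (hx : ∀ i ∈ s, x i ≠ 0) : P.ord (∏ i ∈ s, x i) = ∑ i ∈ s, P.ord (x i) := by
  classical
  induction s using Finset.induction_on with
  | empty => simp [PlaceOver.ord_one]
  | insert a s ha ih =>
    rw [Finset.prod_insert ha, Finset.sum_insert ha,
      P.ord_mul_eq (hx a (Finset.mem_insert_self a s))
        (Finset.prod_ne_zero_iff.2 fun i hi ↦ hx i (Finset.mem_insert_of_mem hi)),
      ih fun i hi ↦ hx i (Finset.mem_insert_of_mem hi)]

/-! ### Transport of places and orders along `K`-automorphisms (Stichtenoth Lemma 3.5.2) -/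

/-- The place `σ⁻¹(P)` (valuation ring `σ⁻¹(𝒪_P)`) for a `K`-algebra automorphism `σ` of `F`
(Stichtenoth Lemma 3.5.2: automorphisms over `K` permute the places). This is
`PlaceOver.comapRingEquiv` of `FunctionFieldConstantExtension` without its `[Finite K]`
hypothesis, which there only serves to put `K` inside `σ⁻¹(𝒪_P)` for an arbitrary ring
automorphism; for `K`-linear `σ` this is automatic. [cite: Stichtenoth2009, Lemma 3.5.2] -/
def comapAlgEquiv (σ : F ≃ₐ[K] F) (P : PlaceOver K F) : PlaceOver K F where
  toValuationSubring := P.toValuationSubring.comap ((σ : F ≃+* F) : F →+* F)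
  ne_top := P.comap_ringEquiv_ne_top (σ : F ≃+* F)
  isDVR := IsAlgFunctionField.isDiscreteValuationRing_of_ne_top_of_algebraMap_mem (K := K) _
    (P.comap_ringEquiv_ne_top (σ : F ≃+* F)) fun c ↦ by
      change σ (algebraMap K F c) ∈ P.toValuationSubring
      rw [AlgEquiv.commutes]; exact P.algebraMap_mem c
  algebraMap_mem c := by
    change σ (algebraMap K F c) ∈ P.toValuationSubring
    rw [AlgEquiv.commutes]; exact P.algebraMap_mem c

/-- Membership in the transported place (definitional). [folklore] -/
theorem mem_comapAlgEquiv_iff (σ : F ≃ₐ[K] F) (P : PlaceOver K F) (x : F) :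
    x ∈ (P.comapAlgEquiv σ).toValuationSubring ↔ σ x ∈ P.toValuationSubring :=
  Iff.rfl

/-- `σ` maps a uniformizer of `σ⁻¹(P)` to a uniformizer of `P` (proof of
`FunctionFieldStepanovProofs.ord_ringEquiv_uniformizer_comapRingEquiv`). [folklore] -/
theorem ord_algEquiv_uniformizer_comapAlgEquiv (σ : F ≃ₐ[K] F) (P : PlaceOver K F) :
    P.ord (σ ((P.comapAlgEquiv σ).uniformizer : F)) = 1 := by
  let eqv : (P.comapAlgEquiv σ).toValuationSubring ≃* P.toValuationSubring :=
    { toFun := fun y => ⟨σ (y : F), y.2⟩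
      invFun := fun y => ⟨σ.symm (y : F), by
        change σ (σ.symm (y : F)) ∈ P.toValuationSubring
        rw [AlgEquiv.apply_symm_apply]; exact y.2⟩
      left_inv := fun y => Subtype.ext (σ.symm_apply_apply (y : F))
      right_inv := fun y => Subtype.ext (σ.apply_symm_apply (y : F))
      map_mul' := fun y z => Subtype.ext (map_mul σ (y : F) z) }
  have hirr : Irreducible (eqv (P.comapAlgEquiv σ).uniformizer) :=
    (MulEquiv.irreducible_iff eqv).2 (P.comapAlgEquiv σ).irreducible_uniformizer
  have hmem : σ ((P.comapAlgEquiv σ).uniformizer : F) ∈ P.toValuationSubring :=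
    ((P.comapAlgEquiv σ).uniformizer).2
  rw [P.ord_of_mem hmem]
  have : (⟨σ ((P.comapAlgEquiv σ).uniformizer : F), hmem⟩ : P.toValuationSubring) =
      eqv (P.comapAlgEquiv σ).uniformizer := rfl
  rw [this, IsDiscreteValuationRing.addVal_uniformizer hirr]
  rfl

/-- **`ord_{σ⁻¹(P)}(x) = ord_P(σ x)`** (automorphisms transport valuations, Stichtenoth
Lemma 3.5.2; proof of `FunctionFieldStepanovProofs.ord_comapRingEquiv`).
[cite: Stichtenoth2009, Lemma 3.5.2] -/
theorem ord_comapAlgEquiv (σ : F ≃ₐ[K] F) (P : PlaceOver K F) (x : F) :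
    (P.comapAlgEquiv σ).ord x = P.ord (σ x) := by
  rcases eq_or_ne x 0 with rfl | hx
  · rw [map_zero, PlaceOver.ord_zero, PlaceOver.ord_zero]
  set P' := P.comapAlgEquiv σ with hP'
  set m : ℤ := P'.ord x with hm
  set π' : F := (P'.uniformizer : F) with hπ'
  have hπ'0 : π' ≠ 0 := P'.coe_uniformizer_ne_zero
  have hσx0 : σ x ≠ 0 := (_root_.map_ne_zero σ).2 hx
  have hσπ0 : σ π' ≠ 0 := (_root_.map_ne_zero σ).2 hπ'0
  set u : F := x * π' ^ (-m) with hu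
  have hu0 : u ≠ 0 := mul_ne_zero hx (zpow_ne_zero _ hπ'0)
  have hπ'1 : P'.ord π' = 1 := by simpa using P'.ord_uniformizer_zpow 1
  have hordu : P'.ord u = 0 := by
    rw [hu, P'.ord_mul_eq hx (zpow_ne_zero _ hπ'0), P'.ord_zpow hπ'0, hπ'1, ← hm]
    ring
  have huO : u ∈ P'.toValuationSubring := (P'.mem_toValuationSubring_iff_ord_nonneg hu0).2 hordu.ge
  have huiO : u⁻¹ ∈ P'.toValuationSubring :=
    (P'.mem_toValuationSubring_iff_ord_nonneg (inv_ne_zero hu0)).2 (by rw [P'.ord_inv hu0]; omega)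
  have hσu : σ u ∈ P.toValuationSubring := huO
  have hσui : (σ u)⁻¹ ∈ P.toValuationSubring := by rw [← map_inv₀]; exact huiO
  have hσu0 : σ u ≠ 0 := (_root_.map_ne_zero σ).2 hu0
  have hordσu : P.ord (σ u) = 0 := by
    have h1 := P.ord_nonneg_of_mem hσu
    have h2 := P.ord_nonneg_of_mem hσui
    rw [P.ord_inv hσu0] at h2
    omega
  have hx' : σ x = σ u * σ π' ^ m := by
    rw [hu, map_mul, map_zpow₀, mul_assoc, ← zpow_add₀ hσπ0, neg_add_cancel, zpow_zero, mul_one]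
  rw [hx', P.ord_mul_eq hσu0 (zpow_ne_zero _ hσπ0), hordσu, P.ord_zpow hσπ0,
    ord_algEquiv_uniformizer_comapAlgEquiv, zero_add, mul_one]

/-- `1⁻¹(P) = P`. [folklore] -/
theorem comapAlgEquiv_one (P : PlaceOver K F) : P.comapAlgEquiv (1 : F ≃ₐ[K] F) = P := by
  apply PlaceOver.ext
  ext x
  rfl

/-! ### Galois transitivity on the zeros of `t` -/

omit [IsAlgFunctionField K F] in
/-- Automorphisms over `K(f)` fix the elements of `K(f)`. [folklore] -/
theorem algEquiv_apply_eq_self_of_mem {f : F} (σ : F ≃ₐ[K⟮f⟯] F) {t : F} (ht : t ∈ K⟮f⟯) :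
    σ t = t :=
  σ.commutes ⟨t, ht⟩

/-- A transported place `σ⁻¹(P)` of a zero of `t ∈ K(f)` (`σ ∈ Gal(F/K(f))`) is again a zero of
`t`, of the same order. [folklore] -/
theorem ord_comapAlgEquiv_of_mem {f : F} (σ : F ≃ₐ[K⟮f⟯] F) (P : PlaceOver K F) {t : F}
    (ht : t ∈ K⟮f⟯) : (P.comapAlgEquiv (σ.restrictScalars K)).ord t = P.ord t := by
  rw [ord_comapAlgEquiv, AlgEquiv.restrictScalars_apply, algEquiv_apply_eq_self_of_mem σ ht]

/-- **The Galois group of `F/K(f)` acts transitively on the zeros of `t`**, for every `t ∈ K(f)`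
with `K(t) = K(f)` (e.g. `t = f - c`, `t = 1/f`): if `P, P'` are zeros of `t` then
`P' = σ⁻¹(P)` for some `σ ∈ Gal(F/K(f))` (Stichtenoth Thm. 3.7.1; classical proof by weak
approximation and the norm `N_{F/K(f)}(x) = ∏_σ σ(x)`). [cite: Stichtenoth2009, Thm. 3.7.1] -/
theorem exists_comapAlgEquiv_eq_of_ord_pos [IsIntegrallyClosedIn K F] {f : F}
    (hf : f ∉ Set.range (algebraMap K F)) [IsGalois K⟮f⟯ F] {t : F} (ht : t ∈ K⟮f⟯)
    (hft : f ∈ K⟮t⟯) {P P' : PlaceOver K F}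
    (hP : 0 < P.ord t) (hP' : 0 < P'.ord t) :
    ∃ σ : F ≃ₐ[K⟮f⟯] F, P.comapAlgEquiv (σ.restrictScalars K) = P' := by
  classical
  have hftr : Transcendental K f := transcendental_of_not_mem_range hf
  haveI := IsAlgFunctionField.finiteDimensional_adjoin_simple (K := K) (F := F) hftr
  have ht0 : t ≠ 0 := by rintro rfl; rw [PlaceOver.ord_zero] at hP; exact lt_irrefl _ hP
  by_contra hne
  push Not at hne
  -- the (finite) set `U` of zeros of `t`
  set U : Finset (PlaceOver K F) :=
    (finite_setOf_ord_ne_zero_holds (K := K) ht0).toFinset.filter fun Q ↦ 0 < Q.ord t with hU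
  have hmemU : ∀ Q : PlaceOver K F, Q ∈ U ↔ 0 < Q.ord t := fun Q ↦ by
    rw [hU, Finset.mem_filter, Set.Finite.mem_toFinset, Set.mem_setOf_eq]
    exact ⟨fun h ↦ h.2, fun h ↦ ⟨h.ne', h⟩⟩
  -- `x`: order `1` at `P'`, a unit `≡ 1` at the other zeros of `t`
  obtain ⟨x, hx⟩ := PlaceOver.weakApproximation U (fun Q ↦ if Q = P' then 0 else 1) (fun _ ↦ 1)
  have hxP' : x ≠ 0 ∧ P'.ord x = 1 := by
    have h := hx P' ((hmemU P').2 hP')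
    simp only [if_true, sub_zero] at h
    exact h
  have hxQ : ∀ Q ∈ U, Q ≠ P' → Q.ord x = 0 := by
    intro Q hQ hQP'
    have h := hx Q hQ
    rw [if_neg hQP'] at h
    -- `x = 1 + (x - 1)`, `ord 1 = 0 < 1 = ord (x - 1)`
    have h1 : Q.ord (1 : F) < Q.ord (x - 1) := by rw [PlaceOver.ord_one, h.2]; exact zero_lt_one
    have h2 := Q.ord_add_eq_left_of_lt one_ne_zero h.1 h1
    rw [add_sub_cancel] at h2
    rw [h2.2, PlaceOver.ord_one]
  have hxQ' : ∀ Q ∈ U, 0 ≤ Q.ord x := by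
    intro Q hQ
    rcases eq_or_ne Q P' with rfl | hQP'
    · rw [hxP'.2]; exact zero_le_one
    · rw [hxQ Q hQ hQP']
  -- the norm `y = ∏_σ σ x ∈ K(f)`
  set y : F := ∏ σ : F ≃ₐ[K⟮f⟯] F, σ x with hy
  have hymem : y ∈ K⟮f⟯ := by
    have h := Algebra.norm_eq_prod_automorphisms K⟮f⟯ (L := F) x
    rw [← hy] at h
    rw [← h]
    exact (Algebra.norm K⟮f⟯ x).2
  have hσx : ∀ σ : F ≃ₐ[K⟮f⟯] F, σ x ≠ 0 := fun σ ↦ (map_ne_zero σ).2 hxP'.1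
  have hy0 : y ≠ 0 := Finset.prod_ne_zero_iff.2 fun σ _ ↦ hσx σ
  -- transported places stay in `U`
  have hcomapU : ∀ (Q : PlaceOver K F) (σ : F ≃ₐ[K⟮f⟯] F), Q ∈ U →
      Q.comapAlgEquiv (σ.restrictScalars K) ∈ U := by
    intro Q σ hQ
    rw [hmemU] at hQ ⊢
    rwa [ord_comapAlgEquiv_of_mem σ Q ht]
  -- `ord_P y = 0`
  have hPy : P.ord y = 0 := by
    rw [hy, P.ord_prod_eq_sum _ _ fun σ _ ↦ hσx σ]
    refine Finset.sum_eq_zero fun σ _ ↦ ?_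
    rw [show P.ord (σ x) = (P.comapAlgEquiv (σ.restrictScalars K)).ord x from
      (ord_comapAlgEquiv (σ.restrictScalars K) P x).symm]
    exact hxQ _ (hcomapU P σ ((hmemU P).2 hP)) (hne σ)
  -- `ord_{P'} y ≥ 1`
  have hP'y : 1 ≤ P'.ord y := by
    rw [hy, P'.ord_prod_eq_sum _ _ fun σ _ ↦ hσx σ,
      ← Finset.add_sum_erase _ _ (Finset.mem_univ (1 : F ≃ₐ[K⟮f⟯] F))]
    have h1 : P'.ord ((1 : F ≃ₐ[K⟮f⟯] F) x) = 1 := by rw [AlgEquiv.one_apply, hxP'.2]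
    rw [h1]
    have h2 : 0 ≤ ∑ σ ∈ (Finset.univ.erase (1 : F ≃ₐ[K⟮f⟯] F)), P'.ord (σ x) := by
      refine Finset.sum_nonneg fun σ _ ↦ ?_
      rw [show P'.ord (σ x) = (P'.comapAlgEquiv (σ.restrictScalars K)).ord x from
        (ord_comapAlgEquiv (σ.restrictScalars K) P' x).symm]
      exact hxQ' _ (hcomapU P' σ ((hmemU P').2 hP'))
    linarith
  -- but `y ∈ K(f) ⊆ K(t)` has orders of a constant sign at the zeros of `t`
  have hyt : y ∈ K⟮t⟯ := (IntermediateField.adjoin_simple_le_iff.2 hft) hymem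
  obtain ⟨m, hm⟩ := exists_ord_eq_mul_ord_of_mem_adjoin hyt hy0
  have h1 := hm P hP
  have h2 := hm P' hP'
  rw [hPy] at h1
  have hm0 : m = 0 := by
    rcases mul_eq_zero.1 h1.symm with h | h
    · exact h
    · exact absurd h hP.ne'
  rw [hm0, zero_mul] at h2
  linarith

/-- **Constant ramification on Galois fibres**: for `F/K(f)` Galois and `t ∈ K(f)` with
`K(t) = K(f)`, all zeros of `t` have the same order. [cite: Stichtenoth2009, Cor. 3.7.2] -/
theorem ord_eq_ord_of_isGalois [IsIntegrallyClosedIn K F] {f : F}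
    (hf : f ∉ Set.range (algebraMap K F)) [IsGalois K⟮f⟯ F] {t : F} (ht : t ∈ K⟮f⟯)
    (hft : f ∈ K⟮t⟯) {P P' : PlaceOver K F}
    (hP : 0 < P.ord t) (hP' : 0 < P'.ord t) : P.ord t = P'.ord t := by
  obtain ⟨σ, rfl⟩ := exists_comapAlgEquiv_eq_of_ord_pos hf ht hft hP hP'
  exact (ord_comapAlgEquiv_of_mem σ P ht).symm

/-! ### Galois fibres: `#U · e = [F : K(f)]` -/

/-- **A Galois fibre**: for `F/K(f)` Galois (all places rational) and `t ∈ K(f)` with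
`K(t) = K(f)`, the zeros of `t` all have the same order `e ≥ 1` and their number `n` satisfies
`n · e = [F : K(f)]` (fundamental equality `Σ_P e_P = [F : K(t)]` on the zero divisor of `t`,
Stichtenoth Thm. 1.4.11, with Cor. 3.7.2). [cite: Stichtenoth2009, Cor. 3.7.2] -/
theorem card_mul_eq_finrank_of_isGalois [IsIntegrallyClosedIn K F]
    (hrat : ∀ P : PlaceOver K F, P.IsRational) {f : F} (hf : f ∉ Set.range (algebraMap K F))
    [IsGalois K⟮f⟯ F] {t : F} (ht : t ∈ K⟮f⟯) (hft : f ∈ K⟮t⟯) (U : Finset (PlaceOver K F))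
    (hU : ∀ P, P ∈ U ↔ 0 < P.ord t) :
    ∃ e : ℕ, 0 < e ∧ (∀ P ∈ U, P.ord t = e) ∧ (U.card : ℤ) * e = Module.finrank K⟮f⟯ F := by
  classical
  have hftr : Transcendental K f := transcendental_of_not_mem_range hf
  haveI := IsAlgFunctionField.finiteDimensional_adjoin_simple (K := K) (F := F) hftr
  -- `t` is not constant and `K(t) = K(f)`
  have ht' : t ∉ Set.range (algebraMap K F) := by
    rintro ⟨c, rfl⟩
    have hbot : K⟮algebraMap K F c⟯ = ⊥ :=
      IntermediateField.adjoin_simple_eq_bot_iff.2 (IntermediateField.mem_bot.2 ⟨c, rfl⟩)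
    rw [hbot, IntermediateField.mem_bot] at hft
    exact hf hft
  have heq : K⟮t⟯ = K⟮f⟯ :=
    le_antisymm (IntermediateField.adjoin_simple_le_iff.2 ht)
      (IntermediateField.adjoin_simple_le_iff.2 hft)
  have hfin : Module.finrank K⟮t⟯ F = Module.finrank K⟮f⟯ F := by rw [heq]
  -- `Σ_{P ∈ U} ord_P t = [F : K(t)] = [F : K(f)]`
  have hsum := sum_ord_sub_eq_finrank hrat ht' 0 U
    (fun P hP ↦ by rw [map_zero, sub_zero]; exact (hU P).1 hP)
    (fun P hP ↦ by rw [map_zero, sub_zero] at hP; exact (hU P).2 hP)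
  simp only [map_zero, sub_zero] at hsum
  rw [hfin] at hsum
  have hd : 0 < Module.finrank K⟮f⟯ F := Module.finrank_pos
  -- `U` is non-empty; all orders are equal
  obtain ⟨P₀, hP₀⟩ : U.Nonempty := by
    rw [Finset.nonempty_iff_ne_empty]
    rintro rfl
    rw [Finset.sum_empty] at hsum
    exact absurd hsum (by exact_mod_cast hd.ne)
  have hP₀' := (hU P₀).1 hP₀
  have hall : ∀ P ∈ U, P.ord t = P₀.ord t := fun P hP ↦
    ord_eq_ord_of_isGalois hf ht hft ((hU P).1 hP) hP₀'
  refine ⟨(P₀.ord t).toNat, by omega, fun P hP ↦ ?_, ?_⟩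
  · rw [hall P hP, Int.toNat_of_nonneg hP₀'.le]
  · rw [Int.toNat_of_nonneg hP₀'.le, ← hsum, Finset.sum_congr rfl hall, Finset.sum_const,
      nsmul_eq_mul]

end PlaceOver

namespace IsBelyiFunction

/-! ### Hurwitz's bound for Galois Belyi functions -/

variable [IsAlgClosed K] [CharZero K]

/-- **Galois Belyi curves have Belyi degree at most `84(g - 1)`.** Let `K` be algebraically closed
of characteristic `0`, `F/K` a function field of genus `g ≥ 2` and `f ∈ F` a Belyi function with
`F/K(f)` Galois. Then `[F : K(f)] ≤ 84 (g - 1)`. Proof: the three fibres of `f` over `0, 1, ∞`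
are Galois orbits (`PlaceOver.exists_comapAlgEquiv_eq_of_ord_pos`), so `nᵢ eᵢ = d = [F : K(f)]`
with common ramification indices `eᵢ`; the Riemann–Hurwitz count `n₀ + n₁ + n_∞ = d + 2 - 2g`
(`card_add_card_add_card_eq_of_isAlgClosed`) becomes `2g - 2 = d (1 - 1/e₀ - 1/e₁ - 1/e_∞)`,
and Hurwitz's signature bound (`card_le_of_riemannHurwitz_signature`) gives `d ≤ 84(g - 1)`. This
is the input "if `X` is a Galois Belyi curve, `deg_B(X) ≤ 84(g - 1)`" of
[cite: Javanpeykar2014, Cor. 1.5.1] (Hurwitz 1893; for the Belyi degree, `deg_B(X) ≤ [F : K(f)]`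
for the Galois Belyi map `f`). -/
theorem finrank_le_of_isGalois {f : F} (hf : IsBelyiFunction K f) [IsGalois K⟮f⟯ F]
    (hg : 2 ≤ genus K F) : Module.finrank K⟮f⟯ F ≤ 84 * (genus K F - 1) := by
  classical
  haveI := isIntegrallyClosedIn_of_isAlgClosed (K := K) (F := F)
  have hrat : ∀ P : PlaceOver K F, P.IsRational := PlaceOver.isRational_of_isAlgClosed
  have hy := hf.not_mem_range
  have hf0 : f ≠ 0 := hf.ne_zero
  have hf1 : f - 1 ≠ 0 := hf.sub_one_ne_zero
  -- the three fibres
  set U₀ : Finset (PlaceOver K F) :=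
    (finite_setOf_ord_ne_zero_holds (K := K) hf0).toFinset.filter fun P ↦ 0 < P.ord f with hU₀
  set U₁ : Finset (PlaceOver K F) :=
    (finite_setOf_ord_ne_zero_holds (K := K) hf1).toFinset.filter fun P ↦ 0 < P.ord (f - 1)
    with hU₁
  set Ui : Finset (PlaceOver K F) :=
    (finite_setOf_ord_ne_zero_holds (K := K) hf0).toFinset.filter fun P ↦ P.ord f < 0 with hUi
  have hmem₀ : ∀ P, P ∈ U₀ ↔ 0 < P.ord f := fun P ↦ by
    rw [hU₀, Finset.mem_filter, Set.Finite.mem_toFinset, Set.mem_setOf_eq]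
    exact ⟨fun h ↦ h.2, fun h ↦ ⟨h.ne', h⟩⟩
  have hmem₁ : ∀ P, P ∈ U₁ ↔ 0 < P.ord (f - 1) := fun P ↦ by
    rw [hU₁, Finset.mem_filter, Set.Finite.mem_toFinset, Set.mem_setOf_eq]
    exact ⟨fun h ↦ h.2, fun h ↦ ⟨h.ne', h⟩⟩
  have hmemi : ∀ P, P ∈ Ui ↔ P.ord f < 0 := fun P ↦ by
    rw [hUi, Finset.mem_filter, Set.Finite.mem_toFinset, Set.mem_setOf_eq]
    exact ⟨fun h ↦ h.2, fun h ↦ ⟨h.ne, h⟩⟩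
  have hmemi' : ∀ P, P ∈ Ui ↔ 0 < P.ord f⁻¹ := fun P ↦ by
    rw [hmemi, PlaceOver.ord_inv _ hf0]; omega
  -- Riemann–Hurwitz count
  have hRH := hf.card_add_card_add_card_eq_of_isAlgClosed U₀ U₁ Ui hmem₀ hmem₁ hmemi
  -- the fibres are Galois orbits: `nᵢ eᵢ = d`
  have hfmem : f ∈ K⟮f⟯ := IntermediateField.mem_adjoin_simple_self K f
  obtain ⟨e₀, he₀, -, h₀⟩ := PlaceOver.card_mul_eq_finrank_of_isGalois hrat hy hfmem hfmem U₀ hmem₀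
  obtain ⟨e₁, he₁, -, h₁⟩ := PlaceOver.card_mul_eq_finrank_of_isGalois hrat hy (t := f - 1)
    (sub_mem hfmem (one_mem _))
    (by
      have h : f - 1 + 1 ∈ K⟮f - 1⟯ :=
        add_mem (IntermediateField.mem_adjoin_simple_self K (f - 1)) (one_mem _)
      rwa [sub_add_cancel] at h)
    U₁ hmem₁
  obtain ⟨ei, hei, -, hi⟩ := PlaceOver.card_mul_eq_finrank_of_isGalois hrat hy (t := f⁻¹)
    (inv_mem hfmem)
    (by
      have h : (f⁻¹)⁻¹ ∈ K⟮f⁻¹⟯ := inv_mem (IntermediateField.mem_adjoin_simple_self K f⁻¹)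
      rwa [inv_inv] at h)
    Ui hmemi'
  -- arithmetic: `2g - 2 = d (1 - 1/e₀ - 1/e₁ - 1/e_∞)`
  set d := Module.finrank K⟮f⟯ F with hd
  set g := genus K F with hgdef
  have he₀' : (0 : ℚ) < e₀ := by exact_mod_cast he₀
  have he₁' : (0 : ℚ) < e₁ := by exact_mod_cast he₁
  have hei' : (0 : ℚ) < ei := by exact_mod_cast hei
  have hn₀ : (U₀.card : ℚ) = d / e₀ := by
    rw [eq_div_iff he₀'.ne']; exact_mod_cast h₀
  have hn₁ : (U₁.card : ℚ) = d / e₁ := by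
    rw [eq_div_iff he₁'.ne']; exact_mod_cast h₁
  have hni : (Ui.card : ℚ) = d / ei := by
    rw [eq_div_iff hei'.ne']; exact_mod_cast hi
  have hRHQ : (U₀.card : ℚ) + U₁.card + Ui.card = d + 2 - 2 * g := by exact_mod_cast hRH
  -- the signature `(0; e₀, e₁, e_∞)` (indices `≥ 2` only)
  let e : Fin 3 → ℕ := ![e₀, e₁, ei]
  have he1 : ∀ i, 1 ≤ e i := by
    intro i; fin_cases i <;> simp [e] <;> omega
  set s : Finset (Fin 3) := Finset.univ.filter fun i ↦ 2 ≤ e i with hs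
  have hsum : ∑ i ∈ s, (1 - 1 / (e i : ℚ)) = ∑ i : Fin 3, (1 - 1 / (e i : ℚ)) := by
    rw [hs]
    refine Finset.sum_filter_of_ne fun i _ hne ↦ ?_
    by_contra h
    have h1 : e i = 1 := by have := he1 i; omega
    rw [h1] at hne
    norm_num at hne
  have hsig : (2 * g - 2 : ℚ) = d * (2 * (0 : ℕ) - 2 + ∑ i ∈ s, (1 - 1 / (e i : ℚ))) := by
    rw [hsum, Fin.sum_univ_three]
    simp only [e, Matrix.cons_val_zero, Matrix.cons_val_one, Matrix.cons_val, Nat.cast_zero,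
      mul_zero, zero_sub]
    have : (d : ℚ) / e₀ + d / e₁ + d / ei = d + 2 - 2 * g := by rw [← hn₀, ← hn₁, ← hni]; exact hRHQ
    field_simp
    field_simp at this
    linarith
  exact card_le_of_riemannHurwitz_signature s e 0 (fun i hi ↦ (Finset.mem_filter.1 hi).2) hg hsig

/-- **The Belyi degree of a Galois Belyi curve is at most `84(g - 1)`** ([cite: Javanpeykar2014,
§1.5]: "If `X` is a Galois Belyi curve, we have `deg_B(X) ≤ 84(g - 1)`"): if `F/K` (genus `g ≥ 2`)
admits a Belyi function `f` with `F/K(f)` Galois, then `deg_B(F/K) ≤ [F : K(f)] ≤ 84(g - 1)`. -/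
theorem belyiDegree_le_of_isGalois {f : F} (hf : IsBelyiFunction K f) [IsGalois K⟮f⟯ F]
    (hg : 2 ≤ genus K F) : belyiDegree K F ≤ 84 * (genus K F - 1) :=
  (belyiDegree_le_finrank hf).trans (hf.finrank_le_of_isGalois hg)

/-! ### The ramification data of a Galois Belyi function, and the signatures in genus `≤ 1` -/

/-- **Riemann–Hurwitz for a Galois Belyi function.** For a Belyi function `f` with `F/K(f)` Galois
(`K` algebraically closed of characteristic `0`), the three fibres over `0, 1, ∞` have constant
ramification indices `e₀, e₁, e_∞ ≥ 1` (`v_P(f) = e₀` at every zero, `v_P(f - 1) = e₁` at every zero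
of `f - 1`, `v_P(f) = -e_∞` at every pole), and with `d = [F : K(f)]`:
`d · (1/e₀ + 1/e₁ + 1/e_∞) = d + 2 - 2g` (the cusp count `n₀ + n₁ + n_∞ = d + 2 - 2g` with
`nᵢ eᵢ = d`). [cite: Stichtenoth2009, Cor. 3.7.2 and Cor. 3.5.5] -/
theorem exists_ramification_of_isGalois {f : F} (hf : IsBelyiFunction K f) [IsGalois K⟮f⟯ F] :
    ∃ e₀ e₁ ei : ℕ, 0 < e₀ ∧ 0 < e₁ ∧ 0 < ei ∧
      (∀ P : PlaceOver K F, 0 < P.ord f → P.ord f = e₀) ∧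
      (∀ P : PlaceOver K F, 0 < P.ord (f - 1) → P.ord (f - 1) = e₁) ∧
      (∀ P : PlaceOver K F, P.ord f < 0 → P.ord f = -ei) ∧
      e₀ ∣ Module.finrank K⟮f⟯ F ∧ e₁ ∣ Module.finrank K⟮f⟯ F ∧ ei ∣ Module.finrank K⟮f⟯ F ∧
      (Module.finrank K⟮f⟯ F : ℚ) * (1 / e₀ + 1 / e₁ + 1 / ei) =
        Module.finrank K⟮f⟯ F + 2 - 2 * genus K F := by
  classical
  haveI := isIntegrallyClosedIn_of_isAlgClosed (K := K) (F := F)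
  have hrat : ∀ P : PlaceOver K F, P.IsRational := PlaceOver.isRational_of_isAlgClosed
  have hy := hf.not_mem_range
  have hf0 : f ≠ 0 := hf.ne_zero
  have hf1 : f - 1 ≠ 0 := hf.sub_one_ne_zero
  set U₀ : Finset (PlaceOver K F) :=
    (finite_setOf_ord_ne_zero_holds (K := K) hf0).toFinset.filter fun P ↦ 0 < P.ord f with hU₀
  set U₁ : Finset (PlaceOver K F) :=
    (finite_setOf_ord_ne_zero_holds (K := K) hf1).toFinset.filter fun P ↦ 0 < P.ord (f - 1)
    with hU₁
  set Ui : Finset (PlaceOver K F) :=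
    (finite_setOf_ord_ne_zero_holds (K := K) hf0).toFinset.filter fun P ↦ P.ord f < 0 with hUi
  have hmem₀ : ∀ P, P ∈ U₀ ↔ 0 < P.ord f := fun P ↦ by
    rw [hU₀, Finset.mem_filter, Set.Finite.mem_toFinset, Set.mem_setOf_eq]
    exact ⟨fun h ↦ h.2, fun h ↦ ⟨h.ne', h⟩⟩
  have hmem₁ : ∀ P, P ∈ U₁ ↔ 0 < P.ord (f - 1) := fun P ↦ by
    rw [hU₁, Finset.mem_filter, Set.Finite.mem_toFinset, Set.mem_setOf_eq]
    exact ⟨fun h ↦ h.2, fun h ↦ ⟨h.ne', h⟩⟩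
  have hmemi : ∀ P, P ∈ Ui ↔ P.ord f < 0 := fun P ↦ by
    rw [hUi, Finset.mem_filter, Set.Finite.mem_toFinset, Set.mem_setOf_eq]
    exact ⟨fun h ↦ h.2, fun h ↦ ⟨h.ne, h⟩⟩
  have hmemi' : ∀ P, P ∈ Ui ↔ 0 < P.ord f⁻¹ := fun P ↦ by
    rw [hmemi, PlaceOver.ord_inv _ hf0]; omega
  have hRH := hf.card_add_card_add_card_eq_of_isAlgClosed U₀ U₁ Ui hmem₀ hmem₁ hmemi
  have hfmem : f ∈ K⟮f⟯ := IntermediateField.mem_adjoin_simple_self K f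
  obtain ⟨e₀, he₀, hc₀, h₀⟩ :=
    PlaceOver.card_mul_eq_finrank_of_isGalois hrat hy hfmem hfmem U₀ hmem₀
  obtain ⟨e₁, he₁, hc₁, h₁⟩ := PlaceOver.card_mul_eq_finrank_of_isGalois hrat hy (t := f - 1)
    (sub_mem hfmem (one_mem _))
    (by
      have h : f - 1 + 1 ∈ K⟮f - 1⟯ :=
        add_mem (IntermediateField.mem_adjoin_simple_self K (f - 1)) (one_mem _)
      rwa [sub_add_cancel] at h)
    U₁ hmem₁
  obtain ⟨ei, hei, hci, hi⟩ := PlaceOver.card_mul_eq_finrank_of_isGalois hrat hy (t := f⁻¹)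
    (inv_mem hfmem)
    (by
      have h : (f⁻¹)⁻¹ ∈ K⟮f⁻¹⟯ := inv_mem (IntermediateField.mem_adjoin_simple_self K f⁻¹)
      rwa [inv_inv] at h)
    Ui hmemi'
  refine ⟨e₀, e₁, ei, he₀, he₁, hei, fun P hP ↦ hc₀ P ((hmem₀ P).2 hP),
    fun P hP ↦ hc₁ P ((hmem₁ P).2 hP), fun P hP ↦ ?_,
    Dvd.intro_left _ (by exact_mod_cast h₀), Dvd.intro_left _ (by exact_mod_cast h₁),
    Dvd.intro_left _ (by exact_mod_cast hi), ?_⟩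
  · have h := hci P ((hmemi' P).2 (by rw [PlaceOver.ord_inv _ hf0]; omega))
    rw [PlaceOver.ord_inv _ hf0] at h
    omega
  · set d := Module.finrank K⟮f⟯ F with hd
    have he₀' : (0 : ℚ) < e₀ := by exact_mod_cast he₀
    have he₁' : (0 : ℚ) < e₁ := by exact_mod_cast he₁
    have hei' : (0 : ℚ) < ei := by exact_mod_cast hei
    have hn₀ : (U₀.card : ℚ) = d / e₀ := by
      rw [eq_div_iff he₀'.ne']; exact_mod_cast h₀
    have hn₁ : (U₁.card : ℚ) = d / e₁ := by
      rw [eq_div_iff he₁'.ne']; exact_mod_cast h₁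
    have hni : (Ui.card : ℚ) = d / ei := by
      rw [eq_div_iff hei'.ne']; exact_mod_cast hi
    have hRHQ : (U₀.card : ℚ) + U₁.card + Ui.card = d + 2 - 2 * genus K F := by
      exact_mod_cast hRH
    rw [hn₀, hn₁, hni] at hRHQ
    rw [← hRHQ]
    ring

/-- Sorting three natural numbers. [folklore] -/
theorem exists_sorted_three (x y z : ℕ) :
    ∃ a b c : ℕ, a ≤ b ∧ b ≤ c ∧ ({x, y, z} : Multiset ℕ) = {a, b, c} := by
  have perm : ∀ u v w : ℕ,
      ({u, v, w} : Multiset ℕ) = {v, u, w} ∧ ({u, v, w} : Multiset ℕ) = {u, w, v} :=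
    fun u v w ↦ ⟨Multiset.cons_swap u v {w}, congr_arg (u ::ₘ ·) (Multiset.cons_swap v w 0)⟩
  rcases le_total x y with hxy | hyx <;> rcases le_total y z with hyz | hzy <;>
    rcases le_total x z with hxz | hzx
  · exact ⟨x, y, z, hxy, hyz, rfl⟩
  · exact ⟨x, y, z, hxy, hyz, rfl⟩
  · exact ⟨x, z, y, hxz, hzy, (perm x y z).2⟩
  · exact ⟨z, x, y, hzx, hxy, (perm x y z).2.trans (perm x z y).1⟩
  · exact ⟨y, x, z, hyx, hxz, (perm x y z).1⟩
  · exact ⟨y, z, x, hyz, hzx, (perm x y z).1.trans (perm y x z).2⟩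
  · exact ⟨z, y, x, hzy, hyx, ((perm x y z).2.trans (perm x z y).1).trans (perm z x y).2⟩
  · exact ⟨z, y, x, hzy, hyx, ((perm x y z).2.trans (perm x z y).1).trans (perm z x y).2⟩

/-- The positive solutions of `1/a + 1/b + 1/c = 1`: `{2, 3, 6}`, `{2, 4, 4}`, `{3, 3, 3}`.
[folklore] -/
theorem inv_add_inv_add_inv_eq_one {a b c : ℕ} (ha : 0 < a) (hb : 0 < b) (hc : 0 < c)
    (h : (1 / a + 1 / b + 1 / c : ℚ) = 1) :
    ({a, b, c} : Multiset ℕ) = {2, 3, 6} ∨ ({a, b, c} : Multiset ℕ) = {2, 4, 4} ∨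
      ({a, b, c} : Multiset ℕ) = {3, 3, 3} := by
  -- reduce to the sorted case
  suffices key : ∀ a b c : ℕ, 0 < a → 0 < b → 0 < c → a ≤ b → b ≤ c →
      (1 / a + 1 / b + 1 / c : ℚ) = 1 →
      ({a, b, c} : Multiset ℕ) = {2, 3, 6} ∨ ({a, b, c} : Multiset ℕ) = {2, 4, 4} ∨
        ({a, b, c} : Multiset ℕ) = {3, 3, 3} by
    obtain ⟨a', b', c', hab, hbc, hm⟩ := exists_sorted_three a b c
    have hmem : ∀ u, u ∈ ({a', b', c'} : Multiset ℕ) → 0 < u := by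
      intro u hu
      rw [← hm] at hu
      simp only [Multiset.insert_eq_cons, Multiset.mem_cons, Multiset.mem_singleton] at hu
      rcases hu with rfl | rfl | rfl <;> assumption
    have hsum : (1 / a' + 1 / b' + 1 / c' : ℚ) = 1 := by
      have e1 : ((({a, b, c} : Multiset ℕ).map fun u : ℕ ↦ (1 / (u : ℚ))).sum) =
          (({a', b', c'} : Multiset ℕ).map fun u : ℕ ↦ (1 / (u : ℚ))).sum := by rw [hm]
      simp only [Multiset.insert_eq_cons, Multiset.map_cons, Multiset.map_singleton,
        Multiset.sum_cons, Multiset.sum_singleton] at e1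
      linarith
    rw [hm]
    exact key a' b' c' (hmem a' (by simp)) (hmem b' (by simp)) (hmem c' (by simp)) hab hbc hsum
  intro a b c ha hb hc hab hbc h
  have ha' : (0 : ℚ) < a := by exact_mod_cast ha
  have hb' : (0 : ℚ) < b := by exact_mod_cast hb
  have hc' : (0 : ℚ) < c := by exact_mod_cast hc
  have hinv : ∀ {m n : ℕ}, 0 < m → m ≤ n → (1 / n : ℚ) ≤ 1 / m := fun hm hmn ↦
    one_div_le_one_div_of_le (by exact_mod_cast hm) (by exact_mod_cast hmn)
  -- `a ∈ {2, 3}`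
  have ha2 : 2 ≤ a := by
    by_contra h1
    have : a = 1 := by omega
    subst this
    have h2 : (0 : ℚ) < 1 / b := by positivity
    have h3 : (0 : ℚ) < 1 / c := by positivity
    push_cast at h
    linarith
  have ha3 : a ≤ 3 := by
    by_contra h4
    have h4' : 4 ≤ a := by omega
    have e1 : (1 / a : ℚ) ≤ 1 / ((4 : ℕ) : ℚ) := hinv (by norm_num) h4'
    have e2 : (1 / b : ℚ) ≤ 1 / ((4 : ℕ) : ℚ) := hinv (by norm_num) (h4'.trans hab)
    have e3 : (1 / c : ℚ) ≤ 1 / ((4 : ℕ) : ℚ) := hinv (by norm_num) (h4'.trans (hab.trans hbc))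
    push_cast at e1 e2 e3
    linarith
  interval_cases a
  · -- `a = 2`: `1/b + 1/c = 1/2`, `b ∈ {3, 4}`
    have hb3 : 3 ≤ b := by
      by_contra h2
      have : b = 2 := by omega
      subst this
      have h3 : (0 : ℚ) < 1 / c := by positivity
      push_cast at h
      linarith
    have hb4 : b ≤ 4 := by
      by_contra h5
      have h5' : 5 ≤ b := by omega
      have e2 : (1 / b : ℚ) ≤ 1 / ((5 : ℕ) : ℚ) := hinv (by norm_num) h5'
      have e3 : (1 / c : ℚ) ≤ 1 / ((5 : ℕ) : ℚ) := hinv (by norm_num) (h5'.trans hbc)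
      push_cast at h e2 e3
      linarith
    interval_cases b
    · -- `b = 3`: `c = 6`
      have : (c : ℚ) = 6 := by
        push_cast at h
        field_simp at h
        linarith
      have hc6 : c = 6 := by exact_mod_cast this
      subst hc6
      left; rfl
    · -- `b = 4`: `c = 4`
      have : (c : ℚ) = 4 := by
        push_cast at h
        field_simp at h
        linarith
      have hc4 : c = 4 := by exact_mod_cast this
      subst hc4
      right; left; rfl
  · -- `a = 3`: `b = c = 3`
    have e2 : (1 / b : ℚ) ≤ 1 / ((3 : ℕ) : ℚ) := hinv (by norm_num) hab
    have e3 : (1 / c : ℚ) ≤ 1 / ((3 : ℕ) : ℚ) := hinv (by norm_num) (hab.trans hbc)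
    push_cast at h e2 e3
    have hb3 : (1 / b : ℚ) = 1 / 3 := by linarith
    have hc3 : (1 / c : ℚ) = 1 / 3 := by linarith
    have hb' : (b : ℚ) = 3 := by
      have := congr_arg (fun x : ℚ ↦ x⁻¹) hb3; simpa using this
    have hc'' : (c : ℚ) = 3 := by
      have := congr_arg (fun x : ℚ ↦ x⁻¹) hc3; simpa using this
    have hb3' : b = 3 := by exact_mod_cast hb'
    have hc3' : c = 3 := by exact_mod_cast hc''
    subst hb3' hc3'
    right; right; rfl

/-- **Galois Belyi functions in genus one have signature `(2,3,6)`, `(2,4,4)` or `(3,3,3)`.**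
For a Galois Belyi function `f` on a function field of genus `1` (an elliptic curve over `K`
algebraically closed of characteristic `0`), the ramification indices over `0, 1, ∞` satisfy
`1/e₀ + 1/e₁ + 1/e_∞ = 1`, hence `{e₀, e₁, e_∞}` is `{2,3,6}`, `{2,4,4}` or `{3,3,3}` (so the Galois
group contains a stabiliser of order `6`, `4` or `3`: the curve has `j = 0` or `1728` — not proved
here). [cite: Stichtenoth2009, Cor. 3.5.5 and Cor. 3.7.2] -/
theorem signature_of_isGalois_of_genus_eq_one {f : F} (hf : IsBelyiFunction K f)
    [IsGalois K⟮f⟯ F] (hg : genus K F = 1) :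
    ∃ e₀ e₁ ei : ℕ,
      (∀ P : PlaceOver K F, 0 < P.ord f → P.ord f = e₀) ∧
      (∀ P : PlaceOver K F, 0 < P.ord (f - 1) → P.ord (f - 1) = e₁) ∧
      (∀ P : PlaceOver K F, P.ord f < 0 → P.ord f = -ei) ∧
      (({e₀, e₁, ei} : Multiset ℕ) = {2, 3, 6} ∨ ({e₀, e₁, ei} : Multiset ℕ) = {2, 4, 4} ∨
        ({e₀, e₁, ei} : Multiset ℕ) = {3, 3, 3}) := by
  obtain ⟨e₀, e₁, ei, he₀, he₁, hei, h₀, h₁, hi, -, -, -, hRH⟩ :=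
    hf.exists_ramification_of_isGalois
  haveI := isIntegrallyClosedIn_of_isAlgClosed (K := K) (F := F)
  have hftr := transcendental_of_not_mem_range hf.not_mem_range
  haveI := IsAlgFunctionField.finiteDimensional_adjoin_simple (K := K) (F := F) hftr
  have hd : (0 : ℚ) < Module.finrank K⟮f⟯ F := by exact_mod_cast Module.finrank_pos
  rw [hg] at hRH
  push_cast at hRH
  have hsum : (1 / e₀ + 1 / e₁ + 1 / ei : ℚ) = 1 := by
    have h2 : (Module.finrank K⟮f⟯ F : ℚ) * (1 / e₀ + 1 / e₁ + 1 / ei - 1) = 0 := by linarith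
    rcases mul_eq_zero.1 h2 with h | h
    · exact absurd h hd.ne'
    · linarith
  exact ⟨e₀, e₁, ei, h₀, h₁, hi, inv_add_inv_add_inv_eq_one he₀ he₁ hei hsum⟩

/-- **The spherical signatures** (Klein): positive `a ≤ b ≤ c` dividing `d ≥ 1` with
`d (1/a + 1/b + 1/c) = d + 2` are `(1, d, d)`, `(2, 2, d/2)`, `(2, 3, 3; d = 12)`,
`(2, 3, 4; d = 24)`, `(2, 3, 5; d = 60)` — cyclic, dihedral, tetrahedral, octahedral,
icosahedral. [folklore] -/
theorem spherical_signature_sorted {a b c d : ℕ} (ha : 0 < a) (hab : a ≤ b) (hbc : b ≤ c)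
    (hd : 0 < d) (had : a ∣ d) (hbd : b ∣ d) (hcd : c ∣ d)
    (h : (d : ℚ) * (1 / a + 1 / b + 1 / c) = d + 2) :
    (a = 1 ∧ b = d ∧ c = d) ∨ (a = 2 ∧ b = 2 ∧ 2 * c = d) ∨ (a = 2 ∧ b = 3 ∧ c = 3 ∧ d = 12) ∨
      (a = 2 ∧ b = 3 ∧ c = 4 ∧ d = 24) ∨ (a = 2 ∧ b = 3 ∧ c = 5 ∧ d = 60) := by
  obtain ⟨A, hA⟩ := had
  obtain ⟨B, hB⟩ := hbd
  obtain ⟨C, hC⟩ := hcd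
  have hb : 0 < b := by omega
  have hc : 0 < c := by omega
  have ha' : (a : ℚ) ≠ 0 := by exact_mod_cast ha.ne'
  have hb' : (b : ℚ) ≠ 0 := by exact_mod_cast hb.ne'
  have hc' : (c : ℚ) ≠ 0 := by exact_mod_cast hc.ne'
  -- `A + B + C = d + 2`
  have hsum : A + B + C = d + 2 := by
    have hAq : (d : ℚ) * (1 / a) = A := by rw [hA]; push_cast; field_simp
    have hBq : (d : ℚ) * (1 / b) = B := by rw [hB]; push_cast; field_simp
    have hCq : (d : ℚ) * (1 / c) = C := by rw [hC]; push_cast; field_simp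
    have : (A : ℚ) + B + C = d + 2 := by rw [← hAq, ← hBq, ← hCq, ← h]; ring
    exact_mod_cast this
  have hA0 : 0 < A := Nat.pos_of_ne_zero fun h0 ↦ by rw [h0, mul_zero] at hA; omega
  have hB0 : 0 < B := Nat.pos_of_ne_zero fun h0 ↦ by rw [h0, mul_zero] at hB; omega
  have hC0 : 0 < C := Nat.pos_of_ne_zero fun h0 ↦ by rw [h0, mul_zero] at hC; omega
  -- `a ≤ 2`
  have ha2 : a ≤ 2 := by
    by_contra h3
    have h3' : 3 ≤ a := by omega
    have e1 : 3 * A ≤ d := by rw [hA]; exact Nat.mul_le_mul_right A h3'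
    have e2 : 3 * B ≤ d := by rw [hB]; exact Nat.mul_le_mul_right B (h3'.trans hab)
    have e3 : 3 * C ≤ d := by rw [hC]; exact Nat.mul_le_mul_right C (h3'.trans (hab.trans hbc))
    omega
  interval_cases a
  · -- `a = 1`
    left
    have hAd : A = d := by omega
    have hBC : B = 1 ∧ C = 1 := by omega
    refine ⟨rfl, ?_, ?_⟩
    · rw [hB, hBC.1, mul_one]
    · rw [hC, hBC.2, mul_one]
  · -- `a = 2`
    right
    have hb2 : 2 ≤ b := hab
    have hb3 : b ≤ 3 := by
      by_contra h4
      have h4' : 4 ≤ b := by omega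
      have e2 : 4 * B ≤ d := by rw [hB]; exact Nat.mul_le_mul_right B h4'
      have e3 : 4 * C ≤ d := by rw [hC]; exact Nat.mul_le_mul_right C (h4'.trans hbc)
      omega
    interval_cases b
    · -- `b = 2`: dihedral
      left
      refine ⟨rfl, rfl, ?_⟩
      have hC2 : C = 2 := by omega
      rw [hC, hC2, mul_comm]
    · -- `b = 3`
      right
      have hc3 : 3 ≤ c := hbc
      have hc5 : c ≤ 5 := by
        by_contra h6
        have h6' : 6 ≤ c := by omega
        have e3 : 6 * C ≤ d := by rw [hC]; exact Nat.mul_le_mul_right C h6'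
        omega
      interval_cases c
      · left; exact ⟨rfl, rfl, rfl, by omega⟩
      · right; left; exact ⟨rfl, rfl, rfl, by omega⟩
      · right; right; exact ⟨rfl, rfl, rfl, by omega⟩

/-- **Galois Belyi functions in genus zero: the platonic signatures (Klein).** For a Galois Belyi
function `f` of degree `d = [F : K(f)] = |Gal|` on a function field of genus `0` (`K` algebraically
closed of characteristic `0`), the ramification indices over `0, 1, ∞` (each dividing `d`) satisfy
`d (1/e₀ + 1/e₁ + 1/e_∞) = d + 2`, so `{e₀, e₁, e_∞}` is one of: `{1, d, d}` (cyclic), `{2, 2, d/2}`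
(dihedral), `{2, 3, 3}` with `d = 12` (tetrahedral), `{2, 3, 4}` with `d = 24` (octahedral),
`{2, 3, 5}` with `d = 60` (icosahedral) — the finite subgroups of `PGL₂`.
[cite: Stichtenoth2009, Cor. 3.5.5 and Cor. 3.7.2] -/
theorem signature_of_isGalois_of_genus_eq_zero {f : F} (hf : IsBelyiFunction K f)
    [IsGalois K⟮f⟯ F] (hg : genus K F = 0) :
    ∃ e₀ e₁ ei : ℕ,
      (∀ P : PlaceOver K F, 0 < P.ord f → P.ord f = e₀) ∧
      (∀ P : PlaceOver K F, 0 < P.ord (f - 1) → P.ord (f - 1) = e₁) ∧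
      (∀ P : PlaceOver K F, P.ord f < 0 → P.ord f = -ei) ∧
      (({e₀, e₁, ei} : Multiset ℕ) = {1, Module.finrank K⟮f⟯ F, Module.finrank K⟮f⟯ F} ∨
        (({e₀, e₁, ei} : Multiset ℕ) = {2, 2, Module.finrank K⟮f⟯ F / 2} ∧
          2 ∣ Module.finrank K⟮f⟯ F) ∨
        (({e₀, e₁, ei} : Multiset ℕ) = {2, 3, 3} ∧ Module.finrank K⟮f⟯ F = 12) ∨
        (({e₀, e₁, ei} : Multiset ℕ) = {2, 3, 4} ∧ Module.finrank K⟮f⟯ F = 24) ∨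
        (({e₀, e₁, ei} : Multiset ℕ) = {2, 3, 5} ∧ Module.finrank K⟮f⟯ F = 60)) := by
  obtain ⟨e₀, e₁, ei, he₀, he₁, hei, h₀, h₁, hi, hd₀, hd₁, hdi, hRH⟩ :=
    hf.exists_ramification_of_isGalois
  haveI := isIntegrallyClosedIn_of_isAlgClosed (K := K) (F := F)
  have hftr := transcendental_of_not_mem_range hf.not_mem_range
  haveI := IsAlgFunctionField.finiteDimensional_adjoin_simple (K := K) (F := F) hftr
  set d := Module.finrank K⟮f⟯ F with hd
  have hdpos : 0 < d := Module.finrank_pos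
  rw [hg] at hRH
  push_cast at hRH
  rw [mul_zero, sub_zero] at hRH
  refine ⟨e₀, e₁, ei, h₀, h₁, hi, ?_⟩
  -- sort and classify
  obtain ⟨a, b, c, hab, hbc, hm⟩ := exists_sorted_three e₀ e₁ ei
  have hmem : ∀ u, u ∈ ({a, b, c} : Multiset ℕ) → 0 < u ∧ u ∣ d := by
    intro u hu
    rw [← hm] at hu
    simp only [Multiset.insert_eq_cons, Multiset.mem_cons, Multiset.mem_singleton] at hu
    rcases hu with rfl | rfl | rfl
    · exact ⟨he₀, hd₀⟩
    · exact ⟨he₁, hd₁⟩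
    · exact ⟨hei, hdi⟩
  have hsum : (d : ℚ) * (1 / a + 1 / b + 1 / c) = d + 2 := by
    have e1 : ((({e₀, e₁, ei} : Multiset ℕ).map fun u : ℕ ↦ (1 / (u : ℚ))).sum) =
        (({a, b, c} : Multiset ℕ).map fun u : ℕ ↦ (1 / (u : ℚ))).sum := by rw [hm]
    simp only [Multiset.insert_eq_cons, Multiset.map_cons, Multiset.map_singleton,
      Multiset.sum_cons, Multiset.sum_singleton] at e1
    rw [← hRH]
    congr 1
    linarith
  obtain ⟨ha, had⟩ := hmem a (by simp)
  obtain ⟨-, hbd⟩ := hmem b (by simp)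
  obtain ⟨-, hcd⟩ := hmem c (by simp)
  rw [hm]
  rcases spherical_signature_sorted ha hab hbc hdpos had hbd hcd hsum with
    ⟨rfl, rfl, rfl⟩ | ⟨rfl, rfl, h2⟩ | ⟨rfl, rfl, rfl, h12⟩ | ⟨rfl, rfl, rfl, h24⟩ |
    ⟨rfl, rfl, rfl, h60⟩
  · left; rfl
  · right; left
    refine ⟨?_, Dvd.intro c h2⟩
    rw [← h2, Nat.mul_div_cancel_left c (by norm_num)]
  · right; right; left; exact ⟨rfl, h12⟩
  · right; right; right; left; exact ⟨rfl, h24⟩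
  · right; right; right; right; exact ⟨rfl, h60⟩

end IsBelyiFunction

end Literature.NumberTheory.DiophantineGeometry.AlgFunctionField

end
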